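import Summits.BirchSwinnertonDyer.BirchSwinnertonDyer.Theorems.Rank2Observatory2DescClFieldCertD
import Summits.BirchSwinnertonDyer.BirchSwinnertonDyer.Theorems.Rank2Observatory2DescClCurveCertE2Defs
import Summits.BirchSwinnertonDyer.BirchSwinnertonDyer.Theorems.Rank2Observatory2DescClKillRowCert
import Summits.BirchSwinnertonDyer.BirchSwinnertonDyer.Theorems.Rank2Observatory2DescKillValid
import HarnessLib

/-!
# BirchSwinnertonDyer — rank ≥ 2 observatory: KERNEL-2DESC-CL ΩD — the per-curve certificate over a dyadic-root-view field record, part 3/7: records and checkers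

HONEST FRAMING: per-curve certified theorems and census instruments; no claim on BSD in rank ≥ 2.

The per-curve layer over the per-field record `ClFieldCertD` of part 2 (complex cubic 2-division field of common
index divisor `2`: `base : ClFieldCertQ2` in the `α`-view for the ODD primes, the second integer `ω = u(α)/d`,
the DYADIC ROOT VIEW for the three primes `P₁ P₂ P₃` above `2`), in the family shape of E2Q2
(`…2DescClCurveCertE2Q2Defs`): every element the certificate names — the 2-division root `e`, `D = F′(e)`, the
whole `T`-unit family — is an `ω`-ELEMENT `x = W₀ + W₁α + W₂ω` (`…2DescClOmegaElt`) given by its `ω`-coordinates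
`W` and the `α`-coordinates `X` of `M·x` (`omegaCheck`; `M = r₁²` a SQUARE prime to `q₁`, `q₂` and the `α`-row
primes, so norms, residue characters, signs and the four auxiliary valuations are read on `X` exactly as in E2Q2
through `omega_dispatch`).  At the primes above `2` (which divide `N(X) = M³N(x)` always) membership is read in
the ROOT VIEW on `X` (`memCheck` / `notMemCheck` of `…2DescPadicRootMem`, multiplier `M`, exponent `vM = v₂(M)`):
the prime dispatch of `2` demands, for each `i ∈ {1, 2, 3}`, that `Pᵢ` be a support prime of the curve or that
the element miss `Pᵢ`.  The support is `T = {W₁₁, W₁₂, W₂₁, W₂₂} ∪` code primes, a code being TAGGED `0` (an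
`α`-registry code `C`, `D ∈ 𝔭_C` by `memCode` on `X_D`) or `i ∈ {1, 2, 3}` (the dyadic prime `Pᵢ`, `D ∈ Pᵢ` by
`memCheck` on `X_D`); the head of the family has SIX entries `−1, ε, γ₁, γ₂, q₁, q₂`; the sieve has FOUR
valuation-parity rows; the parity certificate has `#chars + 5` rows; the kill list is carried in VALIDITY form
(`KillValidCD`, `TwoDescKill.KillValidAt`) over the landed raw-kill record `ClKill`.  This part: records
`ClFieldCertDc` (= `ClFieldCertD` + `r₁`, `vM`), `FamEntryD`, `ClCurveCertD`; checkers `famCheckD`, `admD`, the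
kill clauses, and the per-curve `r`-checker `checkCD r ks`.  Declaration text = E2Q2 part 4 with the `η`-view
replaced by the `ω`-presentation and the dyadic dispatch.  New declarations only.
[cite: Cassels1991LecturesEllipticCurves, §15] [cite: CremonaAlgorithms1997, §3.6] [cite: Cohen1993, §4.8.2, §6.1, §6.5]
[cite: Cassels1986, Ch. 4 (Hensel's lemma)]
-/

set_option linter.dupNamespace false

noncomputable section

open scoped Classical NumberField nonZeroDivisors

open Literature.NumberTheory.NumberFields Polynomial Module NumberField IsDedekindDomain Ideal

namespace Summit.BirchSwinnertonDyer.BirchSwinnertonDyer.Rank2Observatory.TwoDescCl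

open TwoDescCubic ClFieldCertQ2 TwoDescKill TwoDescPadic

/-! ## Small algebra

DEDUPFIX (cert-1 gen 36): the two `lin` lemmas formerly here (`lin_smulCoordsZD`, `lin_constZD`) were, header and
proof, the landed `TwoDescCl.lin_smulCoords` / `TwoDescCl.lin_const` of `…2DescClCurveCertE2Defs`; that module is
imported and the landed lemmas are used by name in parts 5/7 and 6/7.  The record-variable binder is written into the
headers of `ClFieldCertDc.const_of_check2` / `ClFieldCertDc.r₁_pos` (R30: header text distinct from the
`ClFieldCertE2.*` lemmas of the same shape; statements unchanged). -/

/-! ## Records -/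

/-- **Dyadic-root-view field constants**: the field record plus the multiplier `M = r₁²` (a square killing
`𝓞 K / ℤ[α]`, prime to `q₁`, `q₂` and the `α`-row primes) and its `2`-adic valuation `vM`. Pure data. -/
structure ClFieldCertDc where
  /-- the dyadic-root-view field record -/
  fd : ClFieldCertD
  /-- `M = r₁²` -/
  r₁ : ℕ
  /-- `v₂(M)` (the exponent used by the root-view certificates on `X = M·x`) -/
  vM : ℕ

namespace ClFieldCertDc

/-- `M = r₁²`. -/
def M (F : ClFieldCertDc) : ℕ := F.r₁ ^ 2

/-- The dyadic prime datum of tag `i` (`1 ↦ P₁`, `2 ↦ P₂`, otherwise `P₃`). -/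
def P (F : ClFieldCertDc) (i : ℕ) : DyadicCert :=
  if i = 1 then F.fd.P₁ else if i = 2 then F.fd.P₂ else F.fd.P₃

/-- **Constants clause**: `0 < r₁`, `M` prime to `q₁`, to `q₂` and to every `α`-row prime. Computable. -/
def checkConst (F : ClFieldCertDc) : Bool :=
  decide (0 < F.r₁) && decide (Nat.Coprime F.M F.fd.base.q₁) && decide (Nat.Coprime F.M F.fd.base.q₂) &&
    (F.fd.base.primes.all fun e => decide (Nat.Coprime F.M e.p))

/-- **The complex dyadic-root-view field checker with constants.** Computable; `decide +kernel` once per field. -/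
def check2 (F : ClFieldCertDc) : Bool := F.fd.checkD && F.checkConst

variable (F : ClFieldCertDc)

/-- The first distinguished prime of the record: `F.P 1 = F.fd.P₁` (by definition). -/
theorem P_one : F.P 1 = F.fd.P₁ := rfl

/-- The second distinguished prime of the record: `F.P 2 = F.fd.P₂` (by definition). -/
theorem P_two : F.P 2 = F.fd.P₂ := rfl

/-- The third distinguished prime of the record: `F.P 3 = F.fd.P₃` (by definition). -/
theorem P_three : F.P 3 = F.fd.P₃ := rfl

/-- The field clause of a checked record-with-constants. -/
theorem checkD_of_check2 (h : F.check2 = true) : F.fd.checkD = true := by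
  simp only [check2, Bool.and_eq_true] at h; exact h.1

/-- The signature-free core of a checked record-with-constants. -/
theorem coreD_of_check2 (h : F.check2 = true) : F.fd.checkCoreD = true :=
  F.fd.checkCoreD_of_checkD (F.checkD_of_check2 h)

/-- The constants clause of a checked record-with-constants. -/
theorem const_of_check2 (F : ClFieldCertDc) (h : F.check2 = true) : F.checkConst = true := by
  simp only [check2, Bool.and_eq_true] at h; exact h.2

/-- `0 < r₁`. -/
theorem r₁_pos (F : ClFieldCertDc) (hK : F.checkConst = true) : 0 < F.r₁ := by
  simp only [checkConst, Bool.and_eq_true, decide_eq_true_eq] at hK; exact hK.1.1.1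

/-- `0 < M = r₁²`. -/
theorem M_pos (hK : F.checkConst = true) : 0 < F.M := pow_pos (F.r₁_pos hK) 2

/-- `M` is prime to `q₁`. -/
theorem coprime_q₁ (hK : F.checkConst = true) : Nat.Coprime F.M F.fd.base.q₁ := by
  simp only [checkConst, Bool.and_eq_true, decide_eq_true_eq] at hK; exact hK.1.1.2

/-- `M` is prime to `q₂`. -/
theorem coprime_q₂ (hK : F.checkConst = true) : Nat.Coprime F.M F.fd.base.q₂ := by
  simp only [checkConst, Bool.and_eq_true, decide_eq_true_eq] at hK; exact hK.1.2

/-- `M` is prime to every `α`-row prime. -/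
theorem coprime_row (hK : F.checkConst = true) {e : PrimeEntry} (he : e ∈ F.fd.base.primes) :
    Nat.Coprime F.M e.p := by
  simp only [checkConst, Bool.and_eq_true, decide_eq_true_eq, List.all_eq_true] at hK; exact hK.2 e he

end ClFieldCertDc

/-- **An `ω`-family entry**: `kind` (`1` = the element `q₁`, `4` = the element `q₂`, anything else generic),
`X = M·x` in `α`-coordinates, the `ω`-coordinates `W` of `x`, the sign bit, `e = ord_{W₁₁}(x) + 64·ord_{W₂₁}(x)`,
the `invCert` data at `w₁₂` and `w₂₂`, the factorisation `nf` of `|N(X)|`, and the `invCert` data excluding `x`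
from non-support `α`-codes. Pure data. -/
structure FamEntryD where
  /-- `1` = the element `q₁`; `4` = the element `q₂`; otherwise generic -/
  kind : ℕ
  /-- `M · x` in `α`-coordinates -/
  X : ℤ × ℤ × ℤ
  /-- `x` in `ω`-coordinates `(W₀, W₁, W₂)`: `x = W₀ + W₁α + W₂ω` -/
  W : ℤ × ℤ × ℤ
  /-- sign bit at the real place (`true` = negative) -/
  sg : Bool
  /-- `ord_{W₁₁}(x) + 64 · ord_{W₂₁}(x)` -/
  e : ℕ
  /-- `invCert` datum: `X ∉ W₁₂` -/
  inv12 : ℤ × ℤ × ℤ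
  /-- `invCert` datum: `X ∉ W₂₂` -/
  inv22 : ℤ × ℤ × ℤ
  /-- factorisation of `|N(X)|` -/
  nf : List (ℕ × ℕ)
  /-- `α`-view exclusions `(code, invCert datum)` -/
  invsA : List (PCode × (ℤ × ℤ × ℤ))

/-- **Dyadic-root-view per-curve certificate** for `y² = x³ + Ax² + Bx + C`: the 2-division root `e` and
`D = F′(e)` as `ω`-elements (`X = M·`, `W`), the factorisation of `|N(X_D)|` with `α`-exclusions, the `invCert`
data of `X_D` at `w₁₁, w₁₂, w₂₁, w₂₂`, the sieve moduli, the six head entries `−1, ε, γ₁, γ₂, q₁, q₂` of the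
family, and the support codes TAGGED `0` (`α`-code) or `i ∈ {1,2,3}` (the dyadic prime `Pᵢ`; the code slot is
unused) each WITH its family element. Pure data. [cite: Cassels1991LecturesEllipticCurves, §15] -/
structure ClCurveCertD where
  /-- the model `(0, A, 0, B, C)` -/
  A : ℤ
  /-- the model -/
  B : ℤ
  /-- the model -/
  C : ℤ
  /-- irreducibility modulus for `X³ + AX² + BX + C` -/
  pF : ℕ
  /-- `M · e` in `α`-coordinates -/
  Xt : ℤ × ℤ × ℤ
  /-- `e` in `ω`-coordinates -/
  Wt : ℤ × ℤ × ℤ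
  /-- `M · F′(e)` in `α`-coordinates -/
  XD : ℤ × ℤ × ℤ
  /-- `F′(e)` in `ω`-coordinates -/
  WD : ℤ × ℤ × ℤ
  /-- factorisation of `|N(X_D)|` -/
  dn : List (ℕ × ℕ)
  /-- `α`-view exclusions for `D` -/
  dinvA : List (PCode × (ℤ × ℤ × ℤ))
  /-- `invCert` datum: `X_D ∉ W₁₁` -/
  dW11 : ℤ × ℤ × ℤ
  /-- `invCert` datum: `X_D ∉ W₁₂` -/
  dW12 : ℤ × ℤ × ℤ
  /-- `invCert` datum: `X_D ∉ W₂₁` -/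
  dW21 : ℤ × ℤ × ℤ
  /-- `invCert` datum: `X_D ∉ W₂₂` -/
  dW22 : ℤ × ℤ × ℤ
  /-- sieve moduli -/
  Q : List ℕ
  /-- the head of the family: `−1, ε, γ₁, γ₂, q₁, q₂` (six entries) -/
  head : List FamEntryD
  /-- the support codes, tagged (`0` = `α`-code, `i ∈ {1,2,3}` = the dyadic prime `Pᵢ`), each with its element -/
  codes : List ((ℕ × PCode) × FamEntryD)

/-! ## The checkers -/

section Checkers

variable (F : ClFieldCertDc) (cc : ClCurveCertD)

/-- The family: head entries then the code elements. -/
def famD : List FamEntryD := cc.head ++ cc.codes.map Prod.snd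

/-- **Dyadic dispatch** of an element `X = M·x`: for each `i ∈ {1,2,3}`, `Pᵢ` is a support prime of the curve
or `x ∉ Pᵢ` (root view, `notMemCheck` with multiplier `M`). Computable. [cite: Cassels1986, Ch. 4] -/
def dyDispatchD (X : ℤ × ℤ × ℤ) : Bool :=
  [1, 2, 3].all fun i => (cc.codes.any fun bc => bc.1.1 == i) ||
    notMemCheck 2 (F.P i).ra F.fd.N (F.M : ℤ) F.vM X.1 X.2.1 X.2.2

/-- **Prime dispatch**: the rational prime `p` of a norm factorisation is `q₁` or `q₂`, or has an `α`-row each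
of whose codes is a support code or misses the element (`invCert` on `X`), or is `2` and dyadically dispatched.
Computable. -/
def primeDispatchD (X : ℤ × ℤ × ℤ) (invsA : List (PCode × (ℤ × ℤ × ℤ))) (p : ℕ) : Bool :=
  (p == F.fd.base.q₁) || (p == F.fd.base.q₂) ||
    ((F.fd.base.primes.any fun e => e.p == p) &&
      ((F.fd.base.row p).codes.all fun C' => decide (((0 : ℕ), C') ∈ cc.codes.map Prod.fst) ||
        invsA.any fun ci => ci.1 == C' && invCert F.fd.base.a F.fd.base.b F.fd.base.c C' X ci.2)) ||
    ((p == 2) && dyDispatchD F cc X)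

/-- **Support-code clause**: an `α`-code (tag `0`) is present in the registry and its prime contains `D`
(`memCode` on `X_D`); a dyadic code (tag `i`) has `D ∈ Pᵢ` (`memCheck` on `X_D`). Computable. -/
def codeClauseD (bc : (ℕ × PCode) × FamEntryD) : Bool :=
  if bc.1.1 = 0 then
    (F.fd.base.primes.any fun e => e.p == bc.1.2.1) && decide (bc.1.2 ∈ (F.fd.base.row bc.1.2.1).codes) &&
      memCode bc.1.2 cc.XD
  else memCheck 2 (F.P bc.1.1).ra F.fd.N (F.M : ℤ) F.vM cc.XD.1 cc.XD.2.1 cc.XD.2.2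

/-- Kind-specific clause: the element `q₁` is literally `X = (M q₁, 0, 0)`, the element `q₂` is `X = (M q₂, 0, 0)`;
a generic element misses `W₁₂` and `W₂₂` and has certified `ord_{W₁₁}`, `ord_{W₂₁}` (packed in `e`). Computable. -/
def famKindCheckD (f : FamEntryD) : Bool :=
  if f.kind = 1 then decide (f.X = ((F.M : ℤ) * F.fd.base.q₁, 0, 0))
  else if f.kind = 4 then decide (f.X = ((F.M : ℤ) * F.fd.base.q₂, 0, 0))
  else invCert F.fd.base.a F.fd.base.b F.fd.base.c F.fd.base.w₁₂ f.X f.inv12 &&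
    invCert F.fd.base.a F.fd.base.b F.fd.base.c F.fd.base.w₂₂ f.X f.inv22 &&
    ordCheck F.fd.base.q₁ (normFormZ F.fd.base.a F.fd.base.b F.fd.base.c f.X.1 f.X.2.1 f.X.2.2).natAbs (f.e % 64) &&
    ordCheck F.fd.base.q₂ (normFormZ F.fd.base.a F.fd.base.b F.fd.base.c f.X.1 f.X.2.1 f.X.2.2).natAbs (f.e / 64)

/-- **The `ω`-family-entry check.** Computable. [cite: Cassels1991LecturesEllipticCurves, §15] -/
def famCheckD (f : FamEntryD) : Bool :=
  omegaCheck F.fd.u F.fd.d F.M f.X f.W &&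
    signCond F.fd.base.lo F.fd.base.hi f.X f.sg &&
    decide (normFormZ F.fd.base.a F.fd.base.b F.fd.base.c f.X.1 f.X.2.1 f.X.2.2 ≠ 0) &&
    decide (((F.M : ℤ)) ^ 3 ∣ normFormZ F.fd.base.a F.fd.base.b F.fd.base.c f.X.1 f.X.2.1 f.X.2.2) &&
    (F.fd.base.chars.all fun ch => !decide ((ch.1 : ℤ) ∣ evalInt ch.2.1 f.X)) &&
    decide ((normFormZ F.fd.base.a F.fd.base.b F.fd.base.c f.X.1 f.X.2.1 f.X.2.2).natAbs =
      (f.nf.map fun pe => pe.1 ^ pe.2).prod) &&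
    (f.nf.all fun pe => primeDispatchD F cc f.X f.invsA pe.1) &&
    famKindCheckD F f

/-- `log ord_{W₁₁}`: `−1` for `q₁`, `0` for `q₂`, `−(e mod 64)` otherwise. -/
def famL₁₁D (f : FamEntryD) : ℤ := if f.kind = 1 then -1 else if f.kind = 4 then 0 else -((f.e % 64 : ℕ) : ℤ)

/-- `log ord_{W₁₂}`: `−1` for `q₁`, `0` otherwise. -/
def famL₁₂D (f : FamEntryD) : ℤ := if f.kind = 1 then -1 else 0

/-- `log ord_{W₂₁}`: `0` for `q₁`, `−1` for `q₂`, `−(e div 64)` otherwise. -/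
def famL₂₁D (f : FamEntryD) : ℤ := if f.kind = 1 then 0 else if f.kind = 4 then -1 else -((f.e / 64 : ℕ) : ℤ)

/-- `log ord_{W₂₂}`: `−1` for `q₂`, `0` otherwise. -/
def famL₂₂D (f : FamEntryD) : ℤ := if f.kind = 4 then -1 else 0

/-- Row `k` of the parity matrix at an entry (computed on `X`): `0` sign, `1 … 4` parity of `ord` at `W₁₁, W₁₂,
W₂₁, W₂₂`, `5 + i` the Euler bit of the `i`-th residue character. -/
def bitRowD (fc : ClFieldCertQ2) (f : FamEntryD) : ℕ → Bool
  | 0 => f.sg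
  | 1 => !decide ((2 : ℤ) ∣ famL₁₁D f)
  | 2 => !decide ((2 : ℤ) ∣ famL₁₂D f)
  | 3 => !decide ((2 : ℤ) ∣ famL₂₁D f)
  | 4 => !decide ((2 : ℤ) ∣ famL₂₂D f)
  | k + 5 => eulerBit (fc.chars.getD k (3, 0, 0)).1 (evalInt (fc.chars.getD k (3, 0, 0)).2.1 f.X)

/-- The parity matrix. -/
def bitD (k : Fin (F.fd.base.chars.length + 5)) (j : Fin (famD cc).length) : Bool :=
  bitRowD F.fd.base ((famD cc).get j) k

/-- The norms of the family (`N(x) = N(X) / M³`). -/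
def famNormD (j : Fin (famD cc).length) : ℤ :=
  normFormZ F.fd.base.a F.fd.base.b F.fd.base.c ((famD cc).get j).X.1 ((famD cc).get j).X.2.1
    ((famD cc).get j).X.2.2 / (F.M : ℤ) ^ 3

/-- The sign bits of the family. -/
def famSignD (j : Fin (famD cc).length) : Bool := ((famD cc).get j).sg

/-- **The sieve** on pairs `(T, U)` (`T = ∅`): norm-square residues modulo `Q`, sign, parities of `ord` at the four
auxiliary primes. -/
def admD (T : Finset (Fin 0)) (U : Finset (Fin (famD cc).length)) : Bool :=
  admStdQ cc.Q (fun i : Fin 0 => i.elim0) (famNormD F cc) (fun i : Fin 0 => i.elim0) (famSignD cc) T U &&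
    decide (Even (U.filter fun j => bitRowD F.fd.base ((famD cc).get j) 1 = true).card) &&
    decide (Even (U.filter fun j => bitRowD F.fd.base ((famD cc).get j) 2 = true).card) &&
    decide (Even (U.filter fun j => bitRowD F.fd.base ((famD cc).get j) 3 = true).card) &&
    decide (Even (U.filter fun j => bitRowD F.fd.base ((famD cc).get j) 4 = true).card)

/-! ### Kill records over the `ω`-family (validity form) -/

/-- `α`-coordinates of `X_j = M · x_j` for the members of the family, as a `Fin`-family. [folklore] -/
def famCoordsD : Fin (famD cc).length → ℤ × ℤ × ℤ := fun j => ((famD cc).get j).X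

/-- The class of a raw kill as a `Finset` of family indices. [folklore] -/
def ClKill.clsD (k : ClKill) : Finset (Fin (famD cc).length) :=
  Finset.univ.filter fun j : Fin (famD cc).length => j.val ∈ k.U

/-- The representative `z = ∏_{j ∈ U} X_j` of a killed class in `α`-coordinates. [folklore] -/
def ClKill.zD (k : ClKill) : ℤ × ℤ × ℤ :=
  prodCoords F.fd.base.a F.fd.base.b F.fd.base.c noUnitCoords (famCoordsD cc) ∅ (k.clsD cc)

/-- A raw kill as a `KillEntry` over the family coordinates. [folklore] -/
def ClKill.toEntryD (k : ClKill) : KillEntry 0 (famD cc).length := ⟨∅, k.clsD cc, k.zD F cc, k.p, k.fuel⟩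

/-- The kill list of a row as `KillEntry`s. [folklore] -/
def killEntriesD (ks : List ClKill) : List (KillEntry 0 (famD cc).length) := ks.map (ClKill.toEntryD F cc)

/-- The sieve of a row with kills: `admD F cc` minus the killed classes. [folklore] -/
def admKD (ks : List ClKill) : Finset (Fin 0) → Finset (Fin (famD cc).length) → Bool :=
  admKills (admD F cc) (killEntriesD F cc ks)

/-- **Light kill clause, validity form**: `z ≠ 0` and the class is not the trivial class. Computable. [folklore] -/
def ClKill.liteVD (k : ClKill) : Bool :=
  decide (k.zD F cc ≠ ((0 : ℤ), (0 : ℤ), (0 : ℤ))) && decide (k.clsD cc ≠ ∅)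

/-- **The kills of a row, validity form**: every raw kill is at a prime `p` and the quadric pair of its class has
no integer zero primitive at `p` (`TwoDescKill.KillValidAt`, at the `α`-coordinates `(t₁, t₂)` of `X_t = M·e`).
A hypothesis of the soundness theorem, discharged kill by kill by ANY certificate form. [cite: CremonaAlgorithms1997, §3.6] -/
def KillValidCD (ks : List ClKill) : Prop :=
  ∀ k ∈ ks, k.p.Prime ∧ KillValidAt k.p F.fd.base.a F.fd.base.b F.fd.base.c (k.zD F cc) cc.Xt.2.1 cc.Xt.2.2

/-- **The dyadic-root-view per-curve `r`-checker with a kill list (validity form).** `Δ ≠ 0`; `F` irreducible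
mod `pF`; `F_{M}(X_t) = 0`, `F′` consistency; `ω`-consistency of `e` and `D`; `Δ(F) < 0`; `N(X_D) ≠ 0` and
`|N(X_D)| = ∏ p^e` dispatched; the support codes; `X_D ∉ W₁₁, W₁₂, W₂₁, W₂₂`; `Q > 0`; six head entries;
`famCheckD` of the family; the parity certificate; the light kill clauses; FEWER THAN `2^(r+1)` classes pass
`admKD`.  Computable; run by `decide +kernel`. [cite: Cassels1991LecturesEllipticCurves, §15] [cite: CremonaAlgorithms1997, §3.6] -/
def checkCD (r : ℕ) (ks : List ClKill) : Bool :=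
  decide (deltaShort cc.A cc.B cc.C ≠ 0) &&
    noRootMod cc.pF cc.A cc.B cc.C &&
    decide (cubicAtCoords F.fd.base.a F.fd.base.b F.fd.base.c ((F.M : ℤ) * cc.A) ((F.M : ℤ) ^ 2 * cc.B)
      ((F.M : ℤ) ^ 3 * cc.C) cc.Xt = (0, 0, 0)) &&
    decide (derivAtCoords F.fd.base.a F.fd.base.b F.fd.base.c ((F.M : ℤ) * cc.A) ((F.M : ℤ) ^ 2 * cc.B) cc.Xt =
      MonicCubic.mulCoords F.fd.base.a F.fd.base.b F.fd.base.c (smulCoords (F.M : ℤ) cc.XD)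
        (prodPowCoords F.fd.base.a F.fd.base.b F.fd.base.c [])) &&
    omegaCheck F.fd.u F.fd.d F.M cc.Xt cc.Wt &&
    omegaCheck F.fd.u F.fd.d F.M cc.XD cc.WD &&
    decide (MonicCubic.disc cc.A cc.B cc.C < 0) &&
    decide (normFormZ F.fd.base.a F.fd.base.b F.fd.base.c cc.XD.1 cc.XD.2.1 cc.XD.2.2 ≠ 0) &&
    decide ((normFormZ F.fd.base.a F.fd.base.b F.fd.base.c cc.XD.1 cc.XD.2.1 cc.XD.2.2).natAbs =
      (cc.dn.map fun pe => pe.1 ^ pe.2).prod) &&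
    (cc.dn.all fun pe => primeDispatchD F cc cc.XD cc.dinvA pe.1) &&
    (cc.codes.all fun bc => codeClauseD F cc bc) &&
    invCert F.fd.base.a F.fd.base.b F.fd.base.c F.fd.base.w₁₁ cc.XD cc.dW11 &&
    invCert F.fd.base.a F.fd.base.b F.fd.base.c F.fd.base.w₁₂ cc.XD cc.dW12 &&
    invCert F.fd.base.a F.fd.base.b F.fd.base.c F.fd.base.w₂₁ cc.XD cc.dW21 &&
    invCert F.fd.base.a F.fd.base.b F.fd.base.c F.fd.base.w₂₂ cc.XD cc.dW22 &&
    (cc.Q.all fun q => decide (0 < q)) &&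
    decide (cc.head.length = 6) &&
    ((famD cc).all fun f => famCheckD F cc f) &&
    decide (∀ T : Finset (Fin (famD cc).length), T ≠ ∅ →
      ∃ k : Fin (F.fd.base.chars.length + 5), Odd (T.filter fun j => bitD F cc k j = true).card) &&
    (ks.all fun k => k.liteVD F cc) &&
    decide (((Finset.univ ×ˢ Finset.univ).filter
      (fun p : Finset (Fin 0) × Finset (Fin (famD cc).length) => admKD F cc ks p.1 p.2 = true)).card <
        2 ^ (r + 1))

variable {F cc}
/-- The light clauses and the primality of the kill primes give the validity-form list certificate
`killListCheckV` (the product clause holds by `rfl`). [folklore] -/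
theorem killListCheckV_of_liteVD {ks : List ClKill} (hl : ∀ k ∈ ks, k.liteVD F cc = true)
    (hk : KillValidCD F cc ks) :
    killListCheckV F.fd.base.a F.fd.base.b F.fd.base.c noUnitCoords (famCoordsD cc) (killEntriesD F cc ks) =
      true := by
  rw [killListCheckV, List.all_eq_true]
  intro e he
  obtain ⟨k, hkm, rfl⟩ := List.mem_map.mp he
  have h := hl k hkm
  simp only [ClKill.liteVD, Bool.and_eq_true, decide_eq_true_eq] at h
  obtain ⟨hz, -⟩ := h
  simp only [ClKill.toEntryD, Bool.and_eq_true, decide_eq_true_eq]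
  exact ⟨⟨(hk k hkm).1, rfl⟩, hz⟩
/-- The validity of every `KillEntry` of the row. [folklore] -/
theorem killValid_entries_of_killValidCD {ks : List ClKill} (hk : KillValidCD F cc ks) :
    ∀ e ∈ killEntriesD F cc ks,
      KillValidAt e.p F.fd.base.a F.fd.base.b F.fd.base.c e.z cc.Xt.2.1 cc.Xt.2.2 := by
  intro e he
  obtain ⟨k, hkm, rfl⟩ := List.mem_map.mp he
  exact (hk k hkm).2
/-- No listed class is the trivial class. [folklore] -/
theorem noTrivial_of_liteVD {ks : List ClKill} (hl : ∀ k ∈ ks, k.liteVD F cc = true) :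
    ((killEntriesD F cc ks).all fun e => !(decide (e.T = ∅) && decide (e.U = ∅))) = true := by
  rw [List.all_eq_true]
  intro e he
  obtain ⟨k, hkm, rfl⟩ := List.mem_map.mp he
  have h := hl k hkm
  simp only [ClKill.liteVD, Bool.and_eq_true, decide_eq_true_eq] at h
  simp [ClKill.toEntryD, h.2]

end Checkers
end Summit.BirchSwinnertonDyer.BirchSwinnertonDyer.Rank2Observatory.TwoDescCl
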